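import Summits.Ventures.AbcSig.Levels.N5344P1
import Summits.Ventures.AbcSig.Levels.N5344P2
import Summits.Ventures.AbcSig.Levels.N5344P3

/-!
# Venture AbcSig — GENERATED level file, level 5344 (AGGREGATOR of 3 part files)

HONEST FRAMING. As in the part files `N5344<part>.lean`, parts P1, P2, P3 (a MIXED split: parts of
different size-splits of the same generator output landed in the tree at different times; every part carries the orbit
blocks of one contiguous run of orbits of the same certified level file `N5344.engine1.json`,
sha256 `e2fb8eebad1c28300d10d2875e906c2fce0e122fd65e07eb6afce4d8dadb3462`): this file only concatenates the orbit lists and the part summaries into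
`level5344Orbits`, `level5344_wellformed`, `level5344_sieve` (the shapes the row templates consume). The split exists because the
tree's files are ≤ 400 lines and ≤ 200 000 bytes. Union of residual exponents ≥ 7: [7]; orbits not eliminable by
the sieve: none. No Diophantine statement is made here; no claim on ABC or any summit.
-/

namespace Summit.Ventures.AbcSig

/-- All newform orbits of level 5344 (concatenation of the parts, engine order). -/
def level5344Orbits : List OrbitData :=
  level5344OrbitsP1 ++ level5344OrbitsP2 ++ level5344OrbitsP3

/-- Every listed entry is at an odd prime not dividing 5344. -/
theorem level5344_wellformed :
    ∀ o ∈ level5344Orbits, ∀ e ∈ o.coeffs, e.ell.Prime ∧ e.ell ≠ 2 ∧ ¬ e.ell ∣ 5344 := by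
  unfold level5344Orbits
  exact List.forall_mem_append.2 ⟨List.forall_mem_append.2 ⟨level5344_wellformedP1, level5344_wellformedP2⟩, level5344_wellformedP3⟩

/-- **Level 5344 summary.** For a prime exponent `n ≥ 7`, every orbit of level 5344 is sieve-eliminated by the
kernel certificates of the part files, except that the row's predicate `X` is assumed for: orbit_5344_1 if n ∈ [7], orbit_5344_2 if n ∈ [7], orbit_5344_5 if n ∈ [7], orbit_5344_6 if n ∈ [7]. -/
theorem level5344_sieve (n : ℕ) (hn : n.Prime) (hmin : 7 ≤ n) (X : OrbitData → Prop)
    (h_orbit_5344_1 : n ∈ ([7] : List ℕ) → X orbit_5344_1)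
    (h_orbit_5344_2 : n ∈ ([7] : List ℕ) → X orbit_5344_2)
    (h_orbit_5344_5 : n ∈ ([7] : List ℕ) → X orbit_5344_5)
    (h_orbit_5344_6 : n ∈ ([7] : List ℕ) → X orbit_5344_6) :
    ∀ o ∈ level5344Orbits, (∀ e ∈ o.coeffs, e.ell.Prime ∧ e.ell ≠ 2 ∧ ¬ e.ell ∣ 5344) ∧ (o.Eliminated bs04Allowed n ∨ X o) := by
  unfold level5344Orbits
  exact List.forall_mem_append.2 ⟨List.forall_mem_append.2 ⟨(level5344_sieveP1 n hn hmin X h_orbit_5344_1 h_orbit_5344_2 h_orbit_5344_5 h_orbit_5344_6), (level5344_sieveP2 n hn hmin X)⟩, (level5344_sieveP3 n hn hmin X)⟩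

end Summit.Ventures.AbcSig
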